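import Mathlib
import HarnessLib

/-!
# Sharpness of the auxiliary-function method for long-time averages (Tobasco–Goluskin–Doering 2018)

Topic `Literature/Dynamics/Ergodic` (ergodic optimisation / bounds on time averages of ODEs;
the tree has the DISCRETE-TIME abstract half — `Literature.Dynamics.Ergodic.jenkinson_maxErgodicAverage`,
Jenkinson 2018 Def. 2.1/Prop. 2.2/2.3 (i), maximizing measures of a continuous map of a compact
metric space, discharged in `ErgodicOptimizationProofs` — but not the continuous-time
auxiliary-function duality for ODE flows vendored here; Mathlib has neither, 2026-08-15).

I. Tobasco, D. Goluskin, C. R. Doering, *Optimal bounds and extremal trajectories for time averages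
in nonlinear dynamical systems*, Phys. Lett. A 382 (2018) 382–386 = arXiv:1705.07096 (read from
the held text, chunks p0002–p0005). Setting (§1–§2): an autonomous ODE `ẋ = F(x)` on `ℝᵈ` with
`F` continuously differentiable; a continuous quantity of interest `Φ`; the long-time average
`Φ̄(x₀) = limsup_{T→∞} T⁻¹ ∫₀ᵀ Φ(x(t)) dt` along the trajectory with `x(0) = x₀` (their (2));
"`B ⊂ ℝᵈ` a closed bounded region such that trajectories beginning in `B` remain there" (the flow
is assumed well defined on `B` for all `t ≥ 0`, §5); `C¹(B)` = functions on `B` admitting a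
continuously differentiable extension to a neighbourhood of `B` (Note 2). Weak duality (their (7)):
`max_{x₀ ∈ B} Φ̄ ≤ inf_{V ∈ C¹(B)} max_{x ∈ B} {Φ + F·∇V}`.

**Main result (their (8), "strong duality").**
`max_{x₀ ∈ B} Φ̄(x₀) = inf_{V ∈ C¹(B)} max_{x ∈ B} { Φ(x) + F(x)·∇V(x) }`,
the maximum on the left being attained ("there exist `x₀` attaining the maximum", §1), proved in
§5 through the chain (10a)–(10d):
`max_{x₀∈B} Φ̄ = max_{μ ∈ Pr(B), μ invariant} ∫Φ dμ = sup_μ inf_V ∫(Φ + F·∇V)dμ = inf_V sup_μ … =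
inf_V max_B {Φ + F·∇V}` (Birkhoff + extreme points; the Eulerian characterisation of invariance
"`μ` is invariant iff `∫ F·∇ψ dμ = 0` for all smooth compactly supported `ψ`", (11); Sion's
minimax theorem).

Vendored here AS PRINTED as named facts (`def … : Prop`, review-queued, no proof), over
`EuclideanSpace ℝ (Fin d)`:

* `TobascoGoluskinDoering2018_measureForm` (THE named fact) — (8) with attainment on the left
  together with (10a)+(11): there is `m` which is the GREATEST long-time average over forward
  trajectories in `B`, the GREATEST value of `∫ Φ dμ` over Borel probability measures carried by
  `B` that are stationary in the Eulerian sense `∫ ∇ψ·F dμ = 0` for all smooth compactly supported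
  `ψ`, and the GREATEST LOWER BOUND of the auxiliary-function bounds `sup_B (Φ + F·∇V)`,
  `V ∈ C¹(B)`;
* `TobascoGoluskinDoering2018_duality` — the headline (8) alone, PROVED from the fact (projection),
  so that only one unproved statement is vendored (review of p63445).

Modelling choices. Trajectories are curves `x : ℝ → ℝᵈ` solving the ODE on `[0, ∞)`:
`HasDerivWithinAt x (F (x t)) (Set.Ici 0) t` at every `t ≥ 0` — two-sided at `t > 0`, right-sided
at `0`, hence continuous on `[0, ∞)` (a first version with the derivative only within `Set.Ici t`
admitted right-continuous jump curves and was rightly bounced, p63445) — starting and staying in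
`B`; the standing assumption "trajectories beginning in `B` remain there / the flow is defined
on `B` for `t ≥ 0`" is the hypothesis that such a trajectory exists from every `x₀ ∈ B` (for `C¹`,
hence locally Lipschitz, `F` it is then unique, so maximising over trajectories = maximising over
`x₀ ∈ B`). `F·∇V` is the Fréchet derivative `fderiv ℝ V x (F x)`. `B` nonempty is implicit in the
paper (a maximum over `x₀ ∈ B` is taken) and explicit here.

Why it is here. This is the duality behind "sum-of-squares / auxiliary-functional bounds on mean
quantities are sharp" used on the certificate side of route
`Summits/AnomalousDissipation/AnomalousDissipation/Theses/MomentParity`: the negation of its crux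
`QuarticGate` (no loud 4-stationary Galerkin laws) is, level by level on the compact Galerkin ball,
a statement about auxiliary functionals certifying small dissipation, and `CubicParityLoud`'s
corollary ("no quadratic-budget argument bounds 3-D dissipation") is the degree-2 slice of the
same duality. The infinite-dimensional analogue for weak stationary statistical solutions of the
Navier–Stokes equations is Rosa–Temam, arXiv:2010.06730, Thm. 4.1 (not vendored here).
-/

namespace Literature.Dynamics.Ergodic

open _root_.MeasureTheory Filter Set
open scoped Topology

variable {d : ℕ}

/-- The (upper) **long-time average** `Φ̄ = limsup_{T → ∞} T⁻¹ ∫₀ᵀ Φ(x(t)) dt` of an observable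
`Φ` along a curve `x : ℝ → ℝᵈ` (Tobasco–Goluskin–Doering 2018, (2); `Filter.limsup` in `ℝ`, junk
`sSup ∅`/`0`-type value when the means are unbounded, which does not happen for `Φ` continuous and
`x` confined to a compact set). [cite: TobascoGoluskinDoering2018, §1 (2)] -/
noncomputable def timeAvgLimsup (Φ : EuclideanSpace ℝ (Fin d) → ℝ) (x : ℝ → EuclideanSpace ℝ (Fin d)) : ℝ :=
  Filter.limsup (fun T : ℝ => T⁻¹ * ∫ t in (0 : ℝ)..T, Φ (x t)) Filter.atTop

/-- `x : ℝ → ℝᵈ` is a **forward trajectory of `ẋ = F(x)` in `B`**: it starts in `B`, solves the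
ODE on the closed half-line — `HasDerivWithinAt x (F (x t)) (Set.Ici 0) t` for every `t ≥ 0`, which
is the TWO-SIDED derivative `ẋ(t) = F(x(t))` at every `t > 0` (`Set.Ici 0` is a neighbourhood of
such `t`) and the right derivative at `t = 0`; in particular `x` is continuous on `[0, ∞)` and, `F`
being `C¹`, is the unique solution from `x 0` (no jump curves: review of p63445) — and stays in `B`
for all `t ≥ 0` ("trajectories beginning in `B` remain there", Tobasco–Goluskin–Doering 2018, §1;
the derivative convention is Mathlib's `ODE_solution_unique_of_mem_Icc_right`-style one).
[cite: TobascoGoluskinDoering2018, §1] -/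
def IsForwardTrajectoryIn (F : EuclideanSpace ℝ (Fin d) → EuclideanSpace ℝ (Fin d))
    (B : Set (EuclideanSpace ℝ (Fin d))) (x : ℝ → EuclideanSpace ℝ (Fin d)) : Prop :=
  x 0 ∈ B ∧ (∀ t : ℝ, 0 ≤ t → HasDerivWithinAt x (F (x t)) (Set.Ici 0) t) ∧ ∀ t : ℝ, 0 ≤ t → x t ∈ B

/-- The **auxiliary-function bound** `sup_{x ∈ B} { Φ(x) + F(x)·∇V(x) }` attached to an auxiliary
function `V` (Tobasco–Goluskin–Doering 2018, right-hand side of (6)–(8); `F·∇V` as the Fréchet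
derivative of `V` at `x` applied to `F x`). [cite: TobascoGoluskinDoering2018, §2 (6)–(8)] -/
noncomputable def auxBound (F : EuclideanSpace ℝ (Fin d) → EuclideanSpace ℝ (Fin d))
    (B : Set (EuclideanSpace ℝ (Fin d))) (Φ : EuclideanSpace ℝ (Fin d) → ℝ)
    (V : EuclideanSpace ℝ (Fin d) → ℝ) : ℝ :=
  sSup ((fun x => Φ x + fderiv ℝ V x (F x)) '' B)

/-- `V ∈ C¹(B)`: `V` admits a continuously differentiable extension to a neighbourhood of `B`
(Tobasco–Goluskin–Doering 2018, Note 2) — here: `V` itself is `C¹` on some open `U ⊇ B`.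
[cite: TobascoGoluskinDoering2018, §2 Note 2] -/
def IsC1Near (B : Set (EuclideanSpace ℝ (Fin d))) (V : EuclideanSpace ℝ (Fin d) → ℝ) : Prop :=
  ∃ U : Set (EuclideanSpace ℝ (Fin d)), IsOpen U ∧ B ⊆ U ∧ ContDiffOn ℝ 1 V U

/-- **Tobasco–Goluskin–Doering 2018, eq. (8) with (10a) and the Eulerian characterisation of
invariance (11) — strong duality for the auxiliary-function method.** Let `F : ℝᵈ → ℝᵈ` be
continuously differentiable, `Φ : ℝᵈ → ℝ` continuous, and `B ⊂ ℝᵈ` compact and nonempty such that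
from every `x₀ ∈ B` the ODE `ẋ = F(x)` has a forward trajectory remaining in `B`. Then there is a
real `m` which is simultaneously
(a) the GREATEST long-time average `Φ̄ = limsup_T T⁻¹∫₀ᵀ Φ(x(t))dt` over forward trajectories in
`B` ("`max_{x₀ ∈ B} Φ̄(x₀)`", attained, (8)/(10a));
(b) the GREATEST value of `∫ Φ dμ` over Borel probability measures `μ` carried by `B` that are
invariant — invariance being equivalent ((11)–(12)) to the weak stationarity `∫ F·∇ψ dμ = 0` for
every smooth compactly supported `ψ`, the form used here ("`max_{μ invariant} ∫Φ dμ`", (10a));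
(c) the GREATEST LOWER BOUND of the auxiliary-function bounds `max_{x ∈ B}{Φ + F·∇V}` over
`V ∈ C¹(B)` ("`inf_{V ∈ C¹(B)} max_B {Φ + F·∇V}`", (8)/(10d)).
Named fact, no proof here (printed proof, §5: Birkhoff's ergodic theorem and extreme points for
(a) = (b); the Lagrangian `∫(Φ + F·∇V)dμ`, (13), and Sion's minimax theorem for (b) = (c)). The
headline equality (8) alone is the derived `TobascoGoluskinDoering2018_duality` below.
[cite: TobascoGoluskinDoering2018, eq. (8), §5 (10a)–(11)] -/
def TobascoGoluskinDoering2018_measureForm : Prop :=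
  ∀ (d : ℕ) (F : EuclideanSpace ℝ (Fin d) → EuclideanSpace ℝ (Fin d))
    (B : Set (EuclideanSpace ℝ (Fin d))) (Φ : EuclideanSpace ℝ (Fin d) → ℝ),
    ContDiff ℝ 1 F → Continuous Φ → IsCompact B → B.Nonempty →
    (∀ x₀ ∈ B, ∃ x : ℝ → EuclideanSpace ℝ (Fin d), x 0 = x₀ ∧ IsForwardTrajectoryIn F B x) →
    ∃ m : ℝ,
      IsGreatest {a : ℝ | ∃ x : ℝ → EuclideanSpace ℝ (Fin d),
          IsForwardTrajectoryIn F B x ∧ timeAvgLimsup Φ x = a} m ∧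
        IsGreatest {c : ℝ | ∃ μ : Measure (EuclideanSpace ℝ (Fin d)), IsProbabilityMeasure μ ∧
          μ Bᶜ = 0 ∧ (∀ ψ : EuclideanSpace ℝ (Fin d) → ℝ, ContDiff ℝ (⊤ : ℕ∞) ψ →
            HasCompactSupport ψ → ∫ x, fderiv ℝ ψ x (F x) ∂μ = 0) ∧ ∫ x, Φ x ∂μ = c} m ∧
        IsGLB {b : ℝ | ∃ V : EuclideanSpace ℝ (Fin d) → ℝ, IsC1Near B V ∧ auxBound F B Φ V = b} m

/-- **Tobasco–Goluskin–Doering 2018, eq. (8)** in its headline form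
`max_{x₀ ∈ B} Φ̄(x₀) = inf_{V ∈ C¹(B)} max_{x ∈ B} {Φ + F·∇V}` (maximum attained on the left),
DERIVED from the named fact `TobascoGoluskinDoering2018_measureForm` by dropping its middle
conjunct — a theorem, not a second fact. [cite: TobascoGoluskinDoering2018, eq. (8)] -/
theorem TobascoGoluskinDoering2018_duality (h : TobascoGoluskinDoering2018_measureForm) :
    ∀ (d : ℕ) (F : EuclideanSpace ℝ (Fin d) → EuclideanSpace ℝ (Fin d))
      (B : Set (EuclideanSpace ℝ (Fin d))) (Φ : EuclideanSpace ℝ (Fin d) → ℝ),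
      ContDiff ℝ 1 F → Continuous Φ → IsCompact B → B.Nonempty →
      (∀ x₀ ∈ B, ∃ x : ℝ → EuclideanSpace ℝ (Fin d), x 0 = x₀ ∧ IsForwardTrajectoryIn F B x) →
      ∃ m : ℝ,
        IsGreatest {a : ℝ | ∃ x : ℝ → EuclideanSpace ℝ (Fin d),
            IsForwardTrajectoryIn F B x ∧ timeAvgLimsup Φ x = a} m ∧
          IsGLB {b : ℝ | ∃ V : EuclideanSpace ℝ (Fin d) → ℝ, IsC1Near B V ∧ auxBound F B Φ V = b} m := by
  intro d F B Φ hF hΦ hB hBne htraj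
  obtain ⟨m, h1, -, h3⟩ := h d F B Φ hF hΦ hB hBne htraj
  exact ⟨m, h1, h3⟩

/-- Weak duality for a single Dirac-type datum is NOT asserted here; as a sanity check of the
vocabulary only: a constant curve at a zero of `F` inside `B` is a forward trajectory in `B`.
[folklore] -/
theorem isForwardTrajectoryIn_const {F : EuclideanSpace ℝ (Fin d) → EuclideanSpace ℝ (Fin d)}
    {B : Set (EuclideanSpace ℝ (Fin d))} {p : EuclideanSpace ℝ (Fin d)} (hp : p ∈ B) (hF : F p = 0) :
    IsForwardTrajectoryIn F B (fun _ => p) := by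
  refine ⟨hp, fun t _ => ?_, fun _ _ => hp⟩
  rw [hF]
  exact hasDerivWithinAt_const t (Set.Ici 0) p

end Literature.Dynamics.Ergodic
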